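import Summits.Parity.GeneralizedHardyLittlewood.Theorems.GreenTaoLevelTwoMNTwoRationalGauge
import Summits.Parity.GeneralizedHardyLittlewood.Theorems.GreenTaoLevelTwoGITwoCyclicInverseLLLCoeff

/-!
# Route `GreenTaoLevelTwo`, crux `MNTwo` (stmt-Parity-21276), line `birth`, stub `stub_mnVertical`:
# Lemma 28, geometric half: reduced generators of the rotation Bohr set (GT 2008b §11)

Block V5 / H5 of the `stub_mnVertical` census (B. Green, T. Tao, *Quadratic uniformity of the
Möbius function*, Ann. Inst. Fourier 58 (2008) = arXiv:math/0606087, §11, proof of Lemma 28: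
"We shall use some standard results from the geometry of numbers to obtain a 'basis' for the Bohr
set `B_g(0,ρ₂)` … we can then find a proper generalized arithmetic progression
`P = {l₁v₁ + … + l_dv_d : |lⱼ| ≤ Lⱼ}` … such that `B_g(0,cρ₂) ⊆ P ⊆ B_g(0,ρ₂)` … We claim that
`‖h‖_P ≲ ‖h‖_g` for all `h ∈ B_g(0,ρ₃)`").  For the rotation gauge of the tree's `hInv`,
`ν(n) = maxᵢ ‖nαᵢ‖ + |n|/N` (`α : Fin k → ℝ`, REAL frequencies), this def-free file proves the
statement the §11 chain `…MNTwoUniformMajorArc.uniform_major_arc_of_dense` consumes: there are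
`k + 1` integers `v₀, …, v_k ∈ B(ρ₂)` such that every `h` with `ν(h) < ρ₂/C_k` is an integer
combination `h = Σ cⱼvⱼ` with `Σ |cⱼ| ν(vⱼ) ≤ C_k ν(h)`, `C_k = 5(k+1)²2^{(k+1)(k+3)}`.
Route (all tree-backed): replace `αᵢ` by `aᵢ/N`, `aᵢ = round(Nαᵢ)` (the two gauges agree within
a factor `3/2`: `…MNTwoRationalGauge.rotationGauge_perturb_le`); the integer lattice
`{(n, na₁ − m₁N, …, na_k − m_kN)} ⊂ ℤ^{k+1}` (basis `(1,a₁,…,a_k)`, `Ne₁, …, Ne_k`) carries the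
gauge as `‖·‖_∞/N` up to a factor `2`; its LLL-reduced generators
(`…GITwoCyclicInverseLLLCoeff.exists_reduced_generators_int`: `|cⱼ|·‖wⱼ‖ ≤ 2^{n(n+2)}‖Σcⱼwⱼ‖`)
give the `vⱼ` as first coordinates; generators outside `B(ρ₂)` receive the coefficient `0` on
`B(ρ₂/C_k)` and are replaced by `0`.

* `abs_apply_le_norm`, `norm_le_card_mul` — coordinates versus the Euclidean norm on `ℤⁿ ⊂ ℝⁿ`;
* `coe_intCast_eq_zero`, `norm_coe_eq_abs_sub_round` — `ℝ/ℤ` bookkeeping;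
* `exists_generators_rat` — rational frequencies `aᵢ/N`: `v` with `Σ|cⱼ|ν̃(vⱼ) ≤ 2(k+1)²2^{(k+1)(k+3)}ν̃(h)`
  for EVERY `h ∈ ℤ`;
* `exists_generators` — real frequencies: the same with constant `5(k+1)²2^{(k+1)(k+3)}`;
* `exists_bohr_generators` — **Lemma 28, geometric half**: generators inside `B(ρ₂)` representing
  all of `B(ρ₂/C_k)` with `Σ|cⱼ|ν(vⱼ) ≤ C_k ν(h)`.

References: [GreenTao2008QuadraticMobius] arXiv:math/0606087 §11, proof of Lemma 28;
[GreenTao2008U3Inverse] arXiv:math/0503014 §10 (Lemmas 48–49, the geometry of numbers used there).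
-/

noncomputable section

open Finset Real

namespace Summit.Parity.GeneralizedHardyLittlewood.GreenTaoLevelTwoMNTwoBohrGenerators

open Literature.Algebra.EuclideanLattices (intVecToEuclidean intVecToEuclidean_apply
  norm_intVecToEuclidean LatticeInstance)
open Summit.Parity.GeneralizedHardyLittlewood.GreenTaoLevelTwoGITwoCyclicInverse
  (exists_reduced_generators_int)
open Summit.Parity.GeneralizedHardyLittlewood.GreenTaoLevelTwoMNTwoBohrGauge
  (bddAbove_range_norm iSup_norm_nonneg bohrGauge_nonneg bohrGauge_zero)
open Summit.Parity.GeneralizedHardyLittlewood.GreenTaoLevelTwoMNTwoRationalGauge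
  (exists_round_div rotationGauge_perturb_le)
open Summit.Parity.GeneralizedHardyLittlewood.GreenTaoLevelTwoMNTwoRotationBohrSize
  (norm_coe_le_abs')

/-! ### §1 Coordinates and the Euclidean norm on `ℤⁿ ⊂ ℝⁿ` -/

/-- A coordinate is at most the Euclidean norm: `|x_l| ≤ ‖x‖`. [folklore] -/
theorem abs_apply_le_norm (m : ℕ) (x : Fin m → ℤ) (l : Fin m) :
    |(x l : ℝ)| ≤ ‖intVecToEuclidean m x‖ := by
  rw [norm_intVecToEuclidean, ← Real.sqrt_sq_eq_abs]
  exact Real.sqrt_le_sqrt (Finset.single_le_sum (f := fun j => ((x j : ℝ)) ^ 2)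
    (fun j _ => sq_nonneg _) (Finset.mem_univ l))

/-- The Euclidean norm is at most `m` times a bound for the coordinates. [folklore] -/
theorem norm_le_card_mul (m : ℕ) (x : Fin m → ℤ) {T : ℝ} (hT0 : 0 ≤ T)
    (hT : ∀ l, |(x l : ℝ)| ≤ T) : ‖intVecToEuclidean m x‖ ≤ m * T := by
  rw [norm_intVecToEuclidean]
  have hsq : ∑ j, ((x j : ℝ)) ^ 2 ≤ (m * T) ^ 2 := by
    calc ∑ j, ((x j : ℝ)) ^ 2 ≤ ∑ _j : Fin m, T ^ 2 := Finset.sum_le_sum fun j _ => by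
            rw [← sq_abs]; exact pow_le_pow_left₀ (abs_nonneg _) (hT j) 2
      _ = m * T ^ 2 := by rw [Finset.sum_const, Finset.card_univ, Fintype.card_fin, nsmul_eq_mul]
      _ ≤ (m * T) ^ 2 := by
          have hm : (m : ℝ) ≤ (m : ℝ) ^ 2 := by
            rcases Nat.eq_zero_or_pos m with h | h
            · simp [h]
            · have : (1 : ℝ) ≤ m := by exact_mod_cast h
              nlinarith
          nlinarith [sq_nonneg T]
  calc Real.sqrt (∑ j, ((x j : ℝ)) ^ 2) ≤ Real.sqrt ((m * T) ^ 2) := Real.sqrt_le_sqrt hsq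
    _ = m * T := Real.sqrt_sq (by positivity)

/-! ### §2 `ℝ/ℤ` bookkeeping -/

/-- Integers vanish in `ℝ/ℤ`. [folklore] -/
theorem coe_intCast_eq_zero (m : ℤ) : (((m : ℝ) : ℝ) : AddCircle (1 : ℝ)) = 0 := by
  rw [AddCircle.coe_eq_zero_iff]
  exact ⟨m, by simp⟩

/-- `‖x‖_{ℝ/ℤ} = |x − round x|`. [folklore] -/
theorem norm_coe_eq_abs_sub_round (x : ℝ) :
    ‖((x : ℝ) : AddCircle (1 : ℝ))‖ = |x - round x| := by
  rw [AddCircle.norm_eq]; simp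

/-! ### §3 Rational frequencies: the integer lattice and its reduced generators -/

/-- Coordinates of an integer combination of the basis `b₀ = (1, a₀, …, a_{k−1})`,
`b_{i+1} = N e_{i+1}` of the lattice `{(n, na₀ − m₀N, …)} ⊂ ℤ^{k+1}`. [folklore] -/
theorem comb_apply {k : ℕ} (N : ℕ) (a : Fin k → ℤ) (bas : Fin (k + 1) → Fin (k + 1) → ℤ)
    (hbas0 : bas 0 = Fin.cons 1 a) (hbasS : ∀ i : Fin k, bas i.succ = Pi.single i.succ (N : ℤ))
    (g : Fin (k + 1) → ℤ) :
    (∑ l, g l • bas l) 0 = g 0 ∧ ∀ i : Fin k, (∑ l, g l • bas l) i.succ = g 0 * a i + g i.succ * N := by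
  constructor
  · rw [Finset.sum_apply, Fin.sum_univ_succ]
    simp only [Pi.smul_apply, smul_eq_mul, hbas0, Fin.cons_zero, mul_one, hbasS]
    have : ∑ i : Fin k, g i.succ * (Pi.single (i.succ) (N : ℤ) : Fin (k + 1) → ℤ) 0 = 0 :=
      Finset.sum_eq_zero fun i _ => by
        rw [Pi.single_apply, if_neg (Fin.succ_ne_zero i).symm, mul_zero]
    rw [this, add_zero]
  · intro i
    rw [Finset.sum_apply, Fin.sum_univ_succ]
    simp only [Pi.smul_apply, smul_eq_mul, hbas0, Fin.cons_succ, hbasS]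
    congr 1
    rw [Finset.sum_eq_single i]
    · rw [Pi.single_apply, if_pos rfl]
    · intro j _ hj
      rw [Pi.single_apply, if_neg (fun h => hj (Fin.succ_injective _ h).symm), mul_zero]
    · intro h; exact absurd (Finset.mem_univ i) h

/-- **Reduced generators, rational frequencies.**  For `N ≥ 1` and frequencies `α'ᵢ = aᵢ/N`
(`aᵢ ∈ ℤ`) there are integers `v₀, …, v_k` such that EVERY `h ∈ ℤ` is `Σ cⱼvⱼ` (`cⱼ ∈ ℤ`) with
`Σ |cⱼ| ν̃(vⱼ) ≤ 2(k+1)²2^{(k+1)(k+3)} ν̃(h)`, `ν̃(n) = maxᵢ‖nα'ᵢ‖ + |n|/N` (the `vⱼ` are the first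
coordinates of LLL-reduced generators of the lattice `{(n, na₁ − m₁N, …, na_k − m_kN)} ⊂ ℤ^{k+1}`).
[cite: GreenTao2008QuadraticMobius, §11, proof of Lemma 28]
[cite: GreenTao2008U3Inverse, §10, Lemmas 48–49] -/
theorem exists_generators_rat (k : ℕ) {N : ℕ} (hN : 1 ≤ N) (α' : Fin k → ℝ) (a : Fin k → ℤ)
    (ha : ∀ i, α' i = (a i : ℝ) / N) :
    ∃ v : Fin (k + 1) → ℤ, ∀ h : ℤ, ∃ c : Fin (k + 1) → ℤ, h = ∑ j, c j * v j ∧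
      ∑ j, |(c j : ℝ)| *
          ((⨆ i : Fin k, ‖(((v j : ℝ) * α' i : ℝ) : AddCircle (1 : ℝ))‖) + |(v j : ℝ)| / N) ≤
        2 * ((k : ℝ) + 1) ^ 2 * 2 ^ ((k + 1) * (k + 3)) *
          ((⨆ i : Fin k, ‖(((h : ℝ) * α' i : ℝ) : AddCircle (1 : ℝ))‖) + |(h : ℝ)| / N) := by
  classical
  have hNpos : (0 : ℝ) < N := by exact_mod_cast hN
  have hN0 : (N : ℤ) ≠ 0 := by exact_mod_cast (by omega : N ≠ 0)
  -- the basis `b₀ = (1, a)`, `b_{i+1} = N e_{i+1}`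
  obtain ⟨bas, hbas0, hbasS⟩ : ∃ bas : Fin (k + 1) → Fin (k + 1) → ℤ,
      bas 0 = Fin.cons (α := fun _ => ℤ) 1 a ∧ ∀ i : Fin k, bas i.succ = Pi.single i.succ (N : ℤ) :=
    ⟨Fin.cons (α := fun _ => Fin (k + 1) → ℤ) (Fin.cons (α := fun _ => ℤ) 1 a)
        fun i => Pi.single i.succ (N : ℤ), Fin.cons_zero _ _, fun i => Fin.cons_succ _ _ _⟩
  -- linear independence over `ℝ`: upper triangular with diagonal `1, N, …, N`
  have hli : LinearIndependent ℝ (⇑(intVecToEuclidean (k + 1)) ∘ bas) := by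
    let I : LatticeInstance := ⟨k + 1, Matrix.of bas⟩
    have hblock : (Matrix.of bas).BlockTriangular id := by
      intro i j hij
      have hij' : j < i := hij
      rw [Matrix.of_apply]
      rcases Fin.eq_zero_or_eq_succ i with rfl | ⟨i, rfl⟩
      · exact absurd hij' (not_lt.2 (Fin.zero_le j))
      · rw [hbasS, Pi.single_apply, if_neg (ne_of_lt hij')]
    have hdet : I.IsNonsingular := by
      show (Matrix.of bas).det ≠ 0
      rw [Matrix.det_of_upperTriangular hblock]
      refine Finset.prod_ne_zero_iff.2 fun j _ => ?_
      rw [Matrix.of_apply]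
      rcases Fin.eq_zero_or_eq_succ j with rfl | ⟨i, rfl⟩
      · rw [hbas0, Fin.cons_zero]; exact one_ne_zero
      · rw [hbasS, Pi.single_apply, if_pos rfl]; exact hN0
    exact LatticeInstance.linearIndependent_vec hdet
  -- LLL-reduced generators with the same span
  obtain ⟨w, -, hspan, hbound⟩ := exists_reduced_generators_int bas hli
  have hwmem : ∀ j, w j ∈ Submodule.span ℤ (Set.range bas) := fun j => by
    rw [← hspan]; exact Submodule.subset_span (Set.mem_range_self j)
  choose e he using fun j => (Submodule.mem_span_range_iff_exists_fun ℤ).1 (hwmem j)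
  have hw0 : ∀ j, w j 0 = e j 0 := fun j => by
    rw [← he j]; exact (comb_apply N a bas hbas0 hbasS (e j)).1
  have hws : ∀ j i, w j i.succ = e j 0 * a i + e j i.succ * N := fun j i => by
    rw [← he j]; exact (comb_apply N a bas hbas0 hbasS (e j)).2 i
  refine ⟨fun j => w j 0, fun h => ?_⟩
  -- gauge of the generators: `ν̃(vⱼ) ≤ 2‖wⱼ‖/N`
  have hgv : ∀ j, (⨆ i : Fin k, ‖(((w j 0 : ℝ) * α' i : ℝ) : AddCircle (1 : ℝ))‖) +
      |(w j 0 : ℝ)| / N ≤ 2 * ‖intVecToEuclidean (k + 1) (w j)‖ / N := by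
    intro j
    have h1 : (⨆ i : Fin k, ‖(((w j 0 : ℝ) * α' i : ℝ) : AddCircle (1 : ℝ))‖) ≤
        ‖intVecToEuclidean (k + 1) (w j)‖ / N := by
      refine Real.iSup_le (fun i => ?_) (by positivity)
      have e1 : ((w j 0 : ℝ) * α' i : ℝ) = (w j i.succ : ℝ) / N - (e j i.succ : ℝ) := by
        rw [ha i, hw0 j, hws j i]; push_cast; field_simp; ring
      rw [e1, AddCircle.coe_sub, coe_intCast_eq_zero, sub_zero]
      calc ‖((((w j i.succ : ℝ) / N : ℝ)) : AddCircle (1 : ℝ))‖ ≤ |(w j i.succ : ℝ) / N| :=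
            norm_coe_le_abs' _
        _ = |(w j i.succ : ℝ)| / N := by rw [abs_div, abs_of_pos hNpos]
        _ ≤ ‖intVecToEuclidean (k + 1) (w j)‖ / N :=
            div_le_div_of_nonneg_right (abs_apply_le_norm _ _ _) hNpos.le
    have h2 : |(w j 0 : ℝ)| / N ≤ ‖intVecToEuclidean (k + 1) (w j)‖ / N :=
      div_le_div_of_nonneg_right (abs_apply_le_norm _ _ _) hNpos.le
    have e3 : 2 * ‖intVecToEuclidean (k + 1) (w j)‖ / N =
        ‖intVecToEuclidean (k + 1) (w j)‖ / N + ‖intVecToEuclidean (k + 1) (w j)‖ / N := by ring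
    rw [e3]; exact add_le_add h1 h2
  -- the lattice vector of `h`
  set m : Fin k → ℤ := fun i => round ((h : ℝ) * α' i) with hm
  obtain ⟨x, hx0, hxs⟩ : ∃ x : Fin (k + 1) → ℤ, x 0 = h ∧ ∀ i : Fin k, x i.succ = h * a i - m i * N :=
    ⟨Fin.cons (α := fun _ => ℤ) h fun i => h * a i - m i * N, Fin.cons_zero _ _,
      fun i => Fin.cons_succ _ _ _⟩
  have hxmem : x ∈ Submodule.span ℤ (Set.range w) := by
    rw [hspan, Submodule.mem_span_range_iff_exists_fun]
    refine ⟨Fin.cons (α := fun _ => ℤ) h fun i => -m i, funext fun l => ?_⟩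
    rcases Fin.eq_zero_or_eq_succ l with rfl | ⟨i, rfl⟩
    · rw [(comb_apply N a bas hbas0 hbasS _).1, Fin.cons_zero, hx0]
    · rw [(comb_apply N a bas hbas0 hbasS _).2 i, Fin.cons_zero, Fin.cons_succ, hxs]; ring
  obtain ⟨c, hc⟩ := (Submodule.mem_span_range_iff_exists_fun ℤ).1 hxmem
  refine ⟨c, ?_, ?_⟩
  · -- `h = Σ cⱼ vⱼ` is the `0`-th coordinate of `x = Σ cⱼ wⱼ`
    have h0 := congr_fun hc 0
    rw [Finset.sum_apply, hx0] at h0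
    rw [← h0]
    simp only [Pi.smul_apply, smul_eq_mul]
  · show ∑ j, |(c j : ℝ)| * ((⨆ i : Fin k, ‖(((w j 0 : ℝ) * α' i : ℝ) : AddCircle (1 : ℝ))‖) +
        |(w j 0 : ℝ)| / N) ≤ _
    have hsum : ∑ j, (c j : ℝ) • intVecToEuclidean (k + 1) (w j) = intVecToEuclidean (k + 1) x := by
      rw [← hc, map_sum]
      refine Finset.sum_congr rfl fun j _ => ?_
      rw [LinearMap.map_smul_of_tower, Int.cast_smul_eq_zsmul]
    -- `‖x‖ ≤ (k+1) N ν̃(h)`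
    set G := (⨆ i : Fin k, ‖(((h : ℝ) * α' i : ℝ) : AddCircle (1 : ℝ))‖) + |(h : ℝ)| / N with hG
    have hsup0 := iSup_norm_nonneg α' h
    have hG0 : 0 ≤ G := bohrGauge_nonneg α' N h
    have hxl : ∀ l, |(x l : ℝ)| ≤ N * G := by
      intro l
      rcases Fin.eq_zero_or_eq_succ l with rfl | ⟨i, rfl⟩
      · rw [hx0]
        have e4 : |(h : ℝ)| = N * (|(h : ℝ)| / N) := by field_simp
        rw [e4]
        exact mul_le_mul_of_nonneg_left (by rw [hG]; linarith) hNpos.le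
      · rw [hxs i]
        have e1 : ((h * a i - m i * N : ℤ) : ℝ) = N * ((h : ℝ) * α' i - (m i : ℝ)) := by
          rw [ha i]; push_cast; field_simp
        rw [e1, abs_mul, abs_of_pos hNpos]
        refine mul_le_mul_of_nonneg_left ?_ hNpos.le
        have e5 : (m i : ℝ) = round ((h : ℝ) * α' i) := by rw [hm]
        rw [e5, ← norm_coe_eq_abs_sub_round, hG]
        have h6 := le_ciSup (bddAbove_range_norm α' h) i
        have h7 : 0 ≤ |(h : ℝ)| / N := by positivity
        linarith
    have hxnorm : ‖intVecToEuclidean (k + 1) x‖ ≤ ((k + 1 : ℕ) : ℝ) * (N * G) :=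
      norm_le_card_mul (k + 1) x (by positivity) hxl
    have hpow : (k + 1) * (k + 1 + 2) = (k + 1) * (k + 3) := by ring
    -- each term
    have hterm : ∀ j, |(c j : ℝ)| * ((⨆ i : Fin k, ‖(((w j 0 : ℝ) * α' i : ℝ) : AddCircle (1 : ℝ))‖) +
        |(w j 0 : ℝ)| / N) ≤ 2 * 2 ^ ((k + 1) * (k + 3)) * (((k + 1 : ℕ) : ℝ) * G) := by
      intro j
      have hb := hbound (fun j => (c j : ℝ)) j
      rw [hsum, hpow] at hb
      calc |(c j : ℝ)| * ((⨆ i : Fin k, ‖(((w j 0 : ℝ) * α' i : ℝ) : AddCircle (1 : ℝ))‖) +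
              |(w j 0 : ℝ)| / N)
          ≤ |(c j : ℝ)| * (2 * ‖intVecToEuclidean (k + 1) (w j)‖ / N) :=
            mul_le_mul_of_nonneg_left (hgv j) (abs_nonneg _)
        _ = 2 * (|(c j : ℝ)| * ‖intVecToEuclidean (k + 1) (w j)‖) / N := by ring
        _ ≤ 2 * (2 ^ ((k + 1) * (k + 3)) * ‖intVecToEuclidean (k + 1) x‖) / N := by gcongr
        _ ≤ 2 * (2 ^ ((k + 1) * (k + 3)) * (((k + 1 : ℕ) : ℝ) * (N * G))) / N := by gcongr
        _ = 2 * 2 ^ ((k + 1) * (k + 3)) * (((k + 1 : ℕ) : ℝ) * G) := by field_simp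
    calc ∑ j, |(c j : ℝ)| * ((⨆ i : Fin k, ‖(((w j 0 : ℝ) * α' i : ℝ) : AddCircle (1 : ℝ))‖) +
            |(w j 0 : ℝ)| / N)
        ≤ ∑ _j : Fin (k + 1), 2 * 2 ^ ((k + 1) * (k + 3)) * (((k + 1 : ℕ) : ℝ) * G) :=
          Finset.sum_le_sum fun j _ => hterm j
      _ = ((k + 1 : ℕ) : ℝ) * (2 * 2 ^ ((k + 1) * (k + 3)) * (((k + 1 : ℕ) : ℝ) * G)) := by
          rw [Finset.sum_const, Finset.card_univ, Fintype.card_fin, nsmul_eq_mul]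
      _ = 2 * ((k : ℝ) + 1) ^ 2 * 2 ^ ((k + 1) * (k + 3)) * G := by push_cast; ring

/-! ### §4 Real frequencies and the truncation to `B(ρ₂)` -/

/-- **Reduced generators, real frequencies.**  For `N ≥ 1` and `α : Fin k → ℝ` there are integers
`v₀, …, v_k` such that every `h ∈ ℤ` is `Σ cⱼvⱼ` with `Σ |cⱼ| ν(vⱼ) ≤ 5(k+1)²2^{(k+1)(k+3)} ν(h)`,
`ν(n) = maxᵢ‖nαᵢ‖ + |n|/N` (from `exists_generators_rat` for `aᵢ = round(Nαᵢ)`, the two gauges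
agreeing within a factor `3/2`). [cite: GreenTao2008QuadraticMobius, §11, proof of Lemma 28] -/
theorem exists_generators (k : ℕ) {N : ℕ} (hN : 1 ≤ N) (α : Fin k → ℝ) :
    ∃ v : Fin (k + 1) → ℤ, ∀ h : ℤ, ∃ c : Fin (k + 1) → ℤ, h = ∑ j, c j * v j ∧
      ∑ j, |(c j : ℝ)| *
          ((⨆ i : Fin k, ‖(((v j : ℝ) * α i : ℝ) : AddCircle (1 : ℝ))‖) + |(v j : ℝ)| / N) ≤
        5 * ((k : ℝ) + 1) ^ 2 * 2 ^ ((k + 1) * (k + 3)) *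
          ((⨆ i : Fin k, ‖(((h : ℝ) * α i : ℝ) : AddCircle (1 : ℝ))‖) + |(h : ℝ)| / N) := by
  have hNpos : (0 : ℝ) < N := by exact_mod_cast hN
  obtain ⟨a, ha⟩ := exists_round_div α hNpos
  obtain ⟨α', hα'⟩ : ∃ α' : Fin k → ℝ, ∀ i, α' i = (a i : ℝ) / N := ⟨fun i => (a i : ℝ) / N, fun i => rfl⟩
  have hclose : ∀ i, |α i - α' i| ≤ 1 / (2 * (N : ℝ)) := fun i => by rw [hα' i]; exact ha i
  obtain ⟨v, hv⟩ := exists_generators_rat k hN α' a hα'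
  refine ⟨v, fun h => ?_⟩
  obtain ⟨c, hc, hb⟩ := hv h
  refine ⟨c, hc, ?_⟩
  have hcmp := fun n : ℤ => rotationGauge_perturb_le hN α α' (le_refl (N : ℝ)) hclose n
  have h1 : ∀ j, (⨆ i : Fin k, ‖(((v j : ℝ) * α i : ℝ) : AddCircle (1 : ℝ))‖) + |(v j : ℝ)| / N ≤
      3 / 2 * ((⨆ i : Fin k, ‖(((v j : ℝ) * α' i : ℝ) : AddCircle (1 : ℝ))‖) + |(v j : ℝ)| / N) := by
    intro j
    have h := (hcmp (v j)).2.2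
    rw [abs_le] at h
    linarith [h.1, h.2]
  have h2 : (⨆ i : Fin k, ‖(((h : ℝ) * α' i : ℝ) : AddCircle (1 : ℝ))‖) + |(h : ℝ)| / N ≤
      3 / 2 * ((⨆ i : Fin k, ‖(((h : ℝ) * α i : ℝ) : AddCircle (1 : ℝ))‖) + |(h : ℝ)| / N) := by
    have h := (hcmp h).2.1
    rw [abs_le] at h
    linarith [h.1, h.2]
  have hG0 := bohrGauge_nonneg α N h
  have hKG : 0 ≤ ((k : ℝ) + 1) ^ 2 * 2 ^ ((k + 1) * (k + 3)) *
      ((⨆ i : Fin k, ‖(((h : ℝ) * α i : ℝ) : AddCircle (1 : ℝ))‖) + |(h : ℝ)| / N) := by positivity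
  calc ∑ j, |(c j : ℝ)| *
          ((⨆ i : Fin k, ‖(((v j : ℝ) * α i : ℝ) : AddCircle (1 : ℝ))‖) + |(v j : ℝ)| / N)
      ≤ ∑ j, |(c j : ℝ)| *
          (3 / 2 * ((⨆ i : Fin k, ‖(((v j : ℝ) * α' i : ℝ) : AddCircle (1 : ℝ))‖) + |(v j : ℝ)| / N)) :=
        Finset.sum_le_sum fun j _ => mul_le_mul_of_nonneg_left (h1 j) (abs_nonneg _)
    _ = 3 / 2 * ∑ j, |(c j : ℝ)| *
          ((⨆ i : Fin k, ‖(((v j : ℝ) * α' i : ℝ) : AddCircle (1 : ℝ))‖) + |(v j : ℝ)| / N) := by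
        rw [Finset.mul_sum]; exact Finset.sum_congr rfl fun j _ => by ring
    _ ≤ 3 / 2 * (2 * ((k : ℝ) + 1) ^ 2 * 2 ^ ((k + 1) * (k + 3)) *
          ((⨆ i : Fin k, ‖(((h : ℝ) * α' i : ℝ) : AddCircle (1 : ℝ))‖) + |(h : ℝ)| / N)) := by
        gcongr
    _ ≤ 3 / 2 * (2 * ((k : ℝ) + 1) ^ 2 * 2 ^ ((k + 1) * (k + 3)) *
          (3 / 2 * ((⨆ i : Fin k, ‖(((h : ℝ) * α i : ℝ) : AddCircle (1 : ℝ))‖) + |(h : ℝ)| / N))) := by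
        gcongr
    _ ≤ 5 * ((k : ℝ) + 1) ^ 2 * 2 ^ ((k + 1) * (k + 3)) *
          ((⨆ i : Fin k, ‖(((h : ℝ) * α i : ℝ) : AddCircle (1 : ℝ))‖) + |(h : ℝ)| / N) := by
        linarith

/-- **GT 2008b Lemma 28, geometric half: reduced generators of the rotation Bohr set.**  For
`N ≥ 1`, `α : Fin k → ℝ`, `ρ₂ > 0` and `C_k = 5(k+1)²2^{(k+1)(k+3)}` there are integers
`v₀, …, v_k` with `ν(vⱼ) < ρ₂` such that every `h` with `ν(h) < ρ₂/C_k` is `Σ cⱼvⱼ` (`cⱼ ∈ ℤ`) with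
`Σ |cⱼ| ν(vⱼ) ≤ C_k ν(h)` (`ν(n) = maxᵢ‖nαᵢ‖ + |n|/N`) — the input "generators `v` with
`ν(vⱼ) < ρ₂`" of `…MNTwoUniformMajorArc.uniform_major_arc_of_dense` together with the claim
"`‖h‖_P ≲ ‖h‖_g` for all `h ∈ B_g(0,ρ₃)`" of the source.
[cite: GreenTao2008QuadraticMobius, §11, Lemma 28 (proof: the basis of the Bohr set)] -/
theorem exists_bohr_generators (k : ℕ) {N : ℕ} (hN : 1 ≤ N) (α : Fin k → ℝ) {ρ₂ : ℝ}
    (hρ₂ : 0 < ρ₂) :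
    ∃ v : Fin (k + 1) → ℤ,
      (∀ j, (⨆ i : Fin k, ‖(((v j : ℝ) * α i : ℝ) : AddCircle (1 : ℝ))‖) + |(v j : ℝ)| / N < ρ₂) ∧
      ∀ h : ℤ, (⨆ i : Fin k, ‖(((h : ℝ) * α i : ℝ) : AddCircle (1 : ℝ))‖) + |(h : ℝ)| / N <
          ρ₂ / (5 * ((k : ℝ) + 1) ^ 2 * 2 ^ ((k + 1) * (k + 3))) →
        ∃ c : Fin (k + 1) → ℤ, h = ∑ j, c j * v j ∧
          ∑ j, |(c j : ℝ)| *
              ((⨆ i : Fin k, ‖(((v j : ℝ) * α i : ℝ) : AddCircle (1 : ℝ))‖) + |(v j : ℝ)| / N) ≤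
            5 * ((k : ℝ) + 1) ^ 2 * 2 ^ ((k + 1) * (k + 3)) *
              ((⨆ i : Fin k, ‖(((h : ℝ) * α i : ℝ) : AddCircle (1 : ℝ))‖) + |(h : ℝ)| / N) := by
  classical
  obtain ⟨v, hv⟩ := exists_generators k hN α
  set C : ℝ := 5 * ((k : ℝ) + 1) ^ 2 * 2 ^ ((k + 1) * (k + 3)) with hC
  have hCpos : 0 < C := by rw [hC]; positivity
  obtain ⟨v', hv'⟩ : ∃ v' : Fin (k + 1) → ℤ, ∀ j, v' j =
      if (⨆ i : Fin k, ‖(((v j : ℝ) * α i : ℝ) : AddCircle (1 : ℝ))‖) + |(v j : ℝ)| / N < ρ₂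
      then v j else 0 := ⟨_, fun j => rfl⟩
  refine ⟨v', fun j => ?_, fun h hh => ?_⟩
  · by_cases hj : (⨆ i : Fin k, ‖(((v j : ℝ) * α i : ℝ) : AddCircle (1 : ℝ))‖) + |(v j : ℝ)| / N < ρ₂
    · rw [hv' j, if_pos hj]; exact hj
    · rw [hv' j, if_neg hj, bohrGauge_zero]; exact hρ₂
  · obtain ⟨c, hc, hb⟩ := hv h
    have hlt : C * ((⨆ i : Fin k, ‖(((h : ℝ) * α i : ℝ) : AddCircle (1 : ℝ))‖) + |(h : ℝ)| / N) <
        ρ₂ := by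
      rw [lt_div_iff₀ hCpos] at hh; linarith
    -- the coefficients of the generators outside `B(ρ₂)` vanish
    have hzero : ∀ j,
        ¬ ((⨆ i : Fin k, ‖(((v j : ℝ) * α i : ℝ) : AddCircle (1 : ℝ))‖) + |(v j : ℝ)| / N < ρ₂) →
        c j = 0 := by
      intro j hj
      push Not at hj
      have hterm : |(c j : ℝ)| *
          ((⨆ i : Fin k, ‖(((v j : ℝ) * α i : ℝ) : AddCircle (1 : ℝ))‖) + |(v j : ℝ)| / N) ≤
          C * ((⨆ i : Fin k, ‖(((h : ℝ) * α i : ℝ) : AddCircle (1 : ℝ))‖) + |(h : ℝ)| / N) :=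
        (Finset.single_le_sum (f := fun j => |(c j : ℝ)| *
            ((⨆ i : Fin k, ‖(((v j : ℝ) * α i : ℝ) : AddCircle (1 : ℝ))‖) + |(v j : ℝ)| / N))
          (fun j _ => mul_nonneg (abs_nonneg _) (bohrGauge_nonneg α N (v j))) (mem_univ j)).trans hb
      have hvpos : 0 < (⨆ i : Fin k, ‖(((v j : ℝ) * α i : ℝ) : AddCircle (1 : ℝ))‖) + |(v j : ℝ)| / N :=
        lt_of_lt_of_le hρ₂ hj
      have h3 : |(c j : ℝ)| *
          ((⨆ i : Fin k, ‖(((v j : ℝ) * α i : ℝ) : AddCircle (1 : ℝ))‖) + |(v j : ℝ)| / N) <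
          1 * ((⨆ i : Fin k, ‖(((v j : ℝ) * α i : ℝ) : AddCircle (1 : ℝ))‖) + |(v j : ℝ)| / N) := by
        linarith
      have habs : |(c j : ℝ)| < 1 := lt_of_mul_lt_mul_right h3 hvpos.le
      have habs' : |c j| < 1 := by exact_mod_cast habs
      exact Int.abs_lt_one_iff.1 habs'
    refine ⟨c, ?_, ?_⟩
    · rw [hc]
      refine Finset.sum_congr rfl fun j _ => ?_
      by_cases hj : (⨆ i : Fin k, ‖(((v j : ℝ) * α i : ℝ) : AddCircle (1 : ℝ))‖) + |(v j : ℝ)| / N < ρ₂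
      · rw [hv' j, if_pos hj]
      · rw [hzero j hj, zero_mul, zero_mul]
    · refine le_trans (Finset.sum_le_sum fun j _ => ?_) hb
      by_cases hj : (⨆ i : Fin k, ‖(((v j : ℝ) * α i : ℝ) : AddCircle (1 : ℝ))‖) + |(v j : ℝ)| / N < ρ₂
      · rw [hv' j, if_pos hj]
      · rw [hzero j hj]; simp

end Summit.Parity.GeneralizedHardyLittlewood.GreenTaoLevelTwoMNTwoBohrGenerators
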